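import Summits.Schanuel.Schanuel.Theorems.RootDecomp1KHyper58

/-!
# RootDecomp1KHyper — lens 6, generation 17 «BILOG STAIRCASE CELL» (BilogStair.lean edition 2 f0528a77…, 2567 l) — continuation (RootDecomp1KHyper59): EDITION 2 APPENDIX — §F (tree imports) + §G `toPoly`, coefficient lengths/degrees, heights

(lens-6 g17 `BilogStair.lean` edition 2, sha256 f0528a77…5850, own farm rc 0 · 0 sorry · axioms std; critic ACK STATUS L1737 PORT GO LOW (registered, no credit);
port by census-1 gen 15 in ten parts `RootDecomp1KHyper53`–`62` — see the PORT NOTE of part 53; `--supports stmt-Schanuel-33363`; rung 0.)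
-/

open Complex Polynomial IntermediateField Filter
open scoped BigOperators

namespace Summit.Schanuel.Schanuel.Theorems.RootDecomp1KHyper

namespace HyperCell

namespace LatCell

namespace Bilog

variable {n : ℕ}
open Summit.Schanuel.Schanuel.Theorems.RootDecomp1KRelLiouvilleCell (mvPolyMeasure_one_of_polyMeasure)

/-! # EDITION 2 APPENDIX (§F–§J): Case II of the cell, the exp-free rung DECIDED -/

variable {n : ℕ}
open Summit.Schanuel.Schanuel.Theorems.RootDecomp1KRelLiouvilleCell (mvPolyMeasure_one_of_polyMeasure)

/-! ## §F  PORT: the `mvlen` length algebra (§F.1) and the determinant / Sylvester-resultant bounds (§F.2) of the source are the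
tree's `RootDecomp1KHyper42` §A and `RootDecomp1KHyper47` §B (imported); the source's copies are dropped. -/

/-- Norm of a product over a multiset with factors of norm `≤ b`. -/
private theorem norm_multiset_prod_map_le (s : Multiset ℂ) (g : ℂ → ℂ) {b : ℝ} (hb : 0 ≤ b)
    (h : ∀ r ∈ s, ‖g r‖ ≤ b) : ‖(s.map g).prod‖ ≤ b ^ Multiset.card s := by
  induction s using Multiset.induction_on with
  | empty => simp
  | cons a s ih =>
    rw [Multiset.map_cons, Multiset.prod_cons, Multiset.card_cons, pow_succ, norm_mul, mul_comm]
    exact mul_le_mul (ih fun r hr => h r (Multiset.mem_cons_of_mem hr)) (h a (Multiset.mem_cons_self a s))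
      (norm_nonneg _) (pow_nonneg hb _)

/-! ## §G  Polynomials in the second variable over `ℤ[x₁]`: `toPoly`, coefficient lengths and degrees;
small analytic helpers; the measure of `π` as a `Fin 1`-tuple; heights -/

/-- `ℤ[x₁, x₂] → ℤ[x₁][X]`: the SECOND variable becomes the polynomial variable. -/
noncomputable def toPoly : MvPolynomial (Fin 2) ℤ →ₐ[ℤ] Polynomial (MvPolynomial (Fin 1) ℤ) :=
  (MvPolynomial.finSuccEquiv ℤ 1).toAlgHom.comp (MvPolynomial.rename (Equiv.swap (0 : Fin 2) 1))

/-- Definition unfolding of `toPoly`. -/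
theorem toPoly_apply (P : MvPolynomial (Fin 2) ℤ) :
    toPoly P = MvPolynomial.finSuccEquiv ℤ 1 (MvPolynomial.rename (Equiv.swap (0 : Fin 2) 1) P) := rfl

/-- `toPoly X₀ = C X₀`. -/
theorem toPoly_X_zero : toPoly (MvPolynomial.X 0) = Polynomial.C (MvPolynomial.X 0) := by
  rw [toPoly_apply, MvPolynomial.rename_X, Equiv.swap_apply_left,
    show (1 : Fin 2) = Fin.succ 0 from rfl, MvPolynomial.finSuccEquiv_X_succ]

/-- `toPoly X₁ = X`. -/
theorem toPoly_X_one : toPoly (MvPolynomial.X 1) = Polynomial.X := by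
  rw [toPoly_apply, MvPolynomial.rename_X, Equiv.swap_apply_right, MvPolynomial.finSuccEquiv_X_zero]

/-- `toPoly (C c) = C (C c)`. -/
theorem toPoly_C (c : ℤ) : toPoly (MvPolynomial.C c) = Polynomial.C (MvPolynomial.C c) := by
  rw [toPoly_apply, MvPolynomial.rename_C, MvPolynomial.finSuccEquiv_apply, MvPolynomial.eval₂Hom_C,
    RingHom.comp_apply]

/-- `toPoly` is injective on non-zero polynomials. -/
theorem toPoly_ne_zero {P : MvPolynomial (Fin 2) ℤ} (hP : P ≠ 0) : toPoly P ≠ 0 := by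
  rw [toPoly_apply]
  exact (map_ne_zero_iff _ (MvPolynomial.finSuccEquiv ℤ 1).injective).mpr
    ((map_ne_zero_iff _ (MvPolynomial.rename_injective _ (Equiv.injective _))).mpr hP)

/-- Evaluation: `(toPoly P)(x)(t) = P(x, t)`. -/
theorem eval_map_toPoly (P : MvPolynomial (Fin 2) ℤ) (x t : ℂ) :
    ((toPoly P).map (MvPolynomial.aeval ![x]).toRingHom).eval t = MvPolynomial.aeval ![x, t] P := by
  induction P using MvPolynomial.induction_on with
  | C a =>
    rw [toPoly_C, Polynomial.map_C, Polynomial.eval_C, MvPolynomial.aeval_C]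
    simp
  | add p q hp hq => rw [map_add, Polynomial.map_add, Polynomial.eval_add, hp, hq, map_add]
  | mul_X p i hp =>
    rw [map_mul, Polynomial.map_mul, Polynomial.eval_mul, hp, map_mul, MvPolynomial.aeval_X]
    congr 1
    match i with
    | 0 =>
      rw [toPoly_X_zero, Polynomial.map_C, Polynomial.eval_C]
      simp
    | 1 =>
      rw [toPoly_X_one, Polynomial.map_X, Polynomial.eval_X]
      simp

/-- The coefficients of `toPoly P` in terms of those of `P`. -/
theorem coeff_toPoly (P : MvPolynomial (Fin 2) ℤ) (i : ℕ) (m : Fin 1 →₀ ℕ) :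
    MvPolynomial.coeff m ((toPoly P).coeff i) =
      MvPolynomial.coeff (Finsupp.mapDomain (Equiv.swap (0 : Fin 2) 1) (Finsupp.cons i m)) P := by
  rw [toPoly_apply, MvPolynomial.finSuccEquiv_coeff_coeff]
  have hss : (⇑(Equiv.swap (0 : Fin 2) 1) ∘ ⇑(Equiv.swap (0 : Fin 2) 1)) = id := by
    funext j
    exact Equiv.swap_apply_self _ _ _
  conv_lhs => rw [show Finsupp.cons i m = Finsupp.mapDomain (Equiv.swap (0 : Fin 2) 1)
    (Finsupp.mapDomain (Equiv.swap (0 : Fin 2) 1) (Finsupp.cons i m)) by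
      rw [← Finsupp.mapDomain_comp, hss, Finsupp.mapDomain_id]]
  exact MvPolynomial.coeff_rename_mapDomain _ (Equiv.injective _) _ _

/-- The coefficients of `toPoly P` are no longer than `P`. -/
theorem mvlen_toPoly_coeff_le (P : MvPolynomial (Fin 2) ℤ) (i : ℕ) :
    mvlen ((toPoly P).coeff i) ≤ mvlen P := by
  classical
  unfold mvlen
  set ψ : (Fin 1 →₀ ℕ) → (Fin 2 →₀ ℕ) :=
    fun m => Finsupp.mapDomain (Equiv.swap (0 : Fin 2) 1) (Finsupp.cons i m) with hψdef
  have hψ : Function.Injective ψ := by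
    intro m m' h
    have h1 : Finsupp.cons i m = Finsupp.cons i m' :=
      Finsupp.mapDomain_injective (Equiv.injective _) h
    have h2 := congrArg Finsupp.tail h1
    simpa using h2
  have hcoeff : ∀ m, MvPolynomial.coeff m ((toPoly P).coeff i) = MvPolynomial.coeff (ψ m) P :=
    fun m => coeff_toPoly P i m
  calc ∑ m ∈ ((toPoly P).coeff i).support, |MvPolynomial.coeff m ((toPoly P).coeff i)|
      = ∑ m ∈ ((toPoly P).coeff i).support, |MvPolynomial.coeff (ψ m) P| := by simp_rw [hcoeff]
    _ = ∑ d ∈ ((toPoly P).coeff i).support.image ψ, |MvPolynomial.coeff d P| := by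
        rw [Finset.sum_image (fun m _ m' _ h => hψ h)]
    _ ≤ ∑ d ∈ P.support, |MvPolynomial.coeff d P| := by
        refine Finset.sum_le_sum_of_subset_of_nonneg ?_ (fun _ _ _ => abs_nonneg _)
        intro d hd
        obtain ⟨m, hm, rfl⟩ := Finset.mem_image.mp hd
        rw [MvPolynomial.mem_support_iff] at hm ⊢
        rwa [← hcoeff]

/-- The coefficients of `toPoly P` have total degree `≤ totalDegree P - i`. -/
theorem totalDegree_toPoly_coeff_add_le (P : MvPolynomial (Fin 2) ℤ) (i : ℕ) (h : (toPoly P).coeff i ≠ 0) :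
    ((toPoly P).coeff i).totalDegree + i ≤ P.totalDegree := by
  rw [toPoly_apply] at h ⊢
  exact (MvPolynomial.totalDegree_coeff_finSuccEquiv_add_le _ i h).trans
    (MvPolynomial.totalDegree_rename_le _ _)

/-- Coefficients of `toPoly P` have total degree `≤ P.totalDegree`. -/
theorem totalDegree_toPoly_coeff_le (P : MvPolynomial (Fin 2) ℤ) (i : ℕ) :
    ((toPoly P).coeff i).totalDegree ≤ P.totalDegree := by
  by_cases h : (toPoly P).coeff i = 0
  · rw [h, MvPolynomial.totalDegree_zero]; exact Nat.zero_le _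
  · exact le_of_add_le_left (totalDegree_toPoly_coeff_add_le P i h)

/-- An injective renaming preserves the length. -/
theorem mvlen_rename {m : ℕ} (f : Fin m → Fin n) (hf : Function.Injective f) (Q : MvPolynomial (Fin m) ℤ) :
    mvlen (MvPolynomial.rename f Q) = mvlen Q := by
  classical
  unfold mvlen
  rw [MvPolynomial.support_rename_of_injective hf,
    Finset.sum_image (fun a _ b _ h => Finsupp.mapDomain_injective hf h)]
  refine Finset.sum_congr rfl fun d _ => ?_
  rw [MvPolynomial.coeff_rename_mapDomain f hf]

/-- A crude bound for a complex polynomial value. -/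
theorem norm_eval_le (p : ℂ[X]) (x : ℂ) :
    ‖p.eval x‖ ≤ (∑ i ∈ Finset.range (p.natDegree + 1), ‖p.coeff i‖) * max 1 ‖x‖ ^ p.natDegree := by
  rw [Polynomial.eval_eq_sum_range, Finset.sum_mul]
  refine (norm_sum_le _ _).trans (Finset.sum_le_sum fun i hi => ?_)
  rw [norm_mul, norm_pow]
  refine mul_le_mul_of_nonneg_left ?_ (norm_nonneg _)
  have hi' : i ≤ p.natDegree := by rw [Finset.mem_range] at hi; omega
  calc ‖x‖ ^ i ≤ (max 1 ‖x‖) ^ i := pow_le_pow_left₀ (norm_nonneg _) (le_max_right _ _) i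
    _ ≤ (max 1 ‖x‖) ^ p.natDegree := pow_le_pow_right₀ (le_max_left _ _) hi'

/-- The tree's measure of `π`, as a `Fin 1`-tuple. -/
theorem mvPolyMeasure_pi₁ : MvPolyMeasure ![(Real.pi : ℂ)] := mvPolyMeasure_one_of_polyMeasure polyMeasure_pi

/-- `π` is transcendental: no non-zero `P ∈ ℤ[x₁]` vanishes at `π`. -/
theorem aeval_pi_ne_zero {P : MvPolynomial (Fin 1) ℤ} (hP : P ≠ 0) :
    MvPolynomial.aeval ![(Real.pi : ℂ)] P ≠ 0 := by
  obtain ⟨C, τ, _, h⟩ := mvPolyMeasure_pi₁ P.totalDegree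
  have h1 := h P hP le_rfl
  intro h0
  rw [h0, norm_zero, mul_zero] at h1
  exact absurd h1 (by norm_num)

/-- Heights: `3 ≤ H_k`. -/
theorem three_le_hgt (a b : ℕ → ℚ) (k : ℕ) : 3 ≤ hgt a b k := by
  unfold hgt
  have h1 : (1 : ℝ) ≤ ((a k).den : ℝ) := by exact_mod_cast (a k).den_pos
  have h2 : (1 : ℝ) ≤ ((b k).den : ℝ) := by exact_mod_cast (b k).den_pos
  have h3 : (0 : ℝ) ≤ |((a k).num : ℝ)| := abs_nonneg _
  have h4 : (0 : ℝ) ≤ |((b k).num : ℝ)| := abs_nonneg _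
  linarith

/-- `den a_k · den b_k ≤ hgt²`. -/
theorem den_mul_den_le_hgt_sq (a b : ℕ → ℚ) (k : ℕ) :
    (((a k).den * (b k).den : ℕ) : ℝ) ≤ hgt a b k ^ 2 := by
  have h1 : ((a k).den : ℝ) ≤ hgt a b k := by
    unfold hgt
    have := abs_nonneg ((a k).num : ℝ); have := abs_nonneg ((b k).num : ℝ)
    have : (0 : ℝ) ≤ ((b k).den : ℝ) := by positivity
    linarith
  have h2 : ((b k).den : ℝ) ≤ hgt a b k := by
    unfold hgt
    have := abs_nonneg ((a k).num : ℝ); have := abs_nonneg ((b k).num : ℝ)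
    have : (0 : ℝ) ≤ ((a k).den : ℝ) := by positivity
    linarith
  rw [Nat.cast_mul, sq]
  exact mul_le_mul h1 h2 (by positivity) (le_trans (by positivity) h1)

/-- `|num a_k · den b_k| ≤ hgt²` and symmetrically. -/
theorem num_mul_den_le_hgt_sq (a b : ℕ → ℚ) (k : ℕ) :
    |(((a k).num * (b k).den : ℤ) : ℝ)| ≤ hgt a b k ^ 2 ∧ |(((b k).num * (a k).den : ℤ) : ℝ)| ≤ hgt a b k ^ 2 := by
  have h0 := one_le_hgt a b k
  have hA : |((a k).num : ℝ)| ≤ hgt a b k := by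
    unfold hgt
    have := abs_nonneg ((b k).num : ℝ)
    have : (0 : ℝ) ≤ ((a k).den : ℝ) := by positivity
    have : (0 : ℝ) ≤ ((b k).den : ℝ) := by positivity
    linarith
  have hB : |((b k).num : ℝ)| ≤ hgt a b k := by
    unfold hgt
    have := abs_nonneg ((a k).num : ℝ)
    have : (0 : ℝ) ≤ ((a k).den : ℝ) := by positivity
    have : (0 : ℝ) ≤ ((b k).den : ℝ) := by positivity
    linarith
  have h1 : ((a k).den : ℝ) ≤ hgt a b k := by
    unfold hgt
    have := abs_nonneg ((a k).num : ℝ); have := abs_nonneg ((b k).num : ℝ)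
    have : (0 : ℝ) ≤ ((b k).den : ℝ) := by positivity
    linarith
  have h2 : ((b k).den : ℝ) ≤ hgt a b k := by
    unfold hgt
    have := abs_nonneg ((a k).num : ℝ); have := abs_nonneg ((b k).num : ℝ)
    have : (0 : ℝ) ≤ ((a k).den : ℝ) := by positivity
    linarith
  constructor
  · rw [Int.cast_mul, abs_mul, Int.cast_natCast, Nat.abs_cast, sq]
    exact mul_le_mul hA h2 (by positivity) (le_trans (by positivity) h0 |>.trans (le_refl _) |> fun _ =>
      (abs_nonneg _).trans hA)
  · rw [Int.cast_mul, abs_mul, Int.cast_natCast, Nat.abs_cast, sq]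
    exact mul_le_mul hB h1 (by positivity) ((abs_nonneg _).trans hB)

/-- `|a_k|, |b_k| ≤ hgt`. -/
theorem abs_cast_le_hgt (a b : ℕ → ℚ) (k : ℕ) :
    |(a k : ℝ)| ≤ hgt a b k ∧ |(b k : ℝ)| ≤ hgt a b k := by
  have hA : |((a k).num : ℝ)| ≤ hgt a b k := by
    unfold hgt
    have := abs_nonneg ((b k).num : ℝ)
    have : (0 : ℝ) ≤ ((a k).den : ℝ) := by positivity
    have : (0 : ℝ) ≤ ((b k).den : ℝ) := by positivity
    linarith
  have hB : |((b k).num : ℝ)| ≤ hgt a b k := by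
    unfold hgt
    have := abs_nonneg ((a k).num : ℝ)
    have : (0 : ℝ) ≤ ((a k).den : ℝ) := by positivity
    have : (0 : ℝ) ≤ ((b k).den : ℝ) := by positivity
    linarith
  have key : ∀ q : ℚ, |(q : ℝ)| ≤ |(q.num : ℝ)| := by
    intro q
    rw [Rat.cast_def, abs_div, Nat.abs_cast]
    exact div_le_self (abs_nonneg _) (by exact_mod_cast q.den_pos)
  exact ⟨(key _).trans hA, (key _).trans hB⟩

end Bilog
end LatCell
end HyperCell
end Summit.Schanuel.Schanuel.Theorems.RootDecomp1KHyper
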